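import Literature.NumberTheory.PAdicHodge.AinfWeierstrassEtaPeriodHom
import Literature.NumberTheory.PAdicHodge.BdRPlusDVR
import HarnessLib

/-!
# Independence of the two period maps `∫ω`, `∫η : T_pŴ(𝒪_{ℂ_F}) → B_dR⁺(F)` from `Fil¹`-transversality

Topic `Literature/NumberTheory/PAdicHodge`; THEOREMS ONLY. The hypothesis `hind` of the admissibility criterion
`PeriodRingData.isAdmissible_of_two_periodMaps` (tree `GaloisRepresentations/AdmissibleOfTwoPeriods`) for the pair
`(∫ω, ∫η)` of `AinfWeierstrassTateModule` / `AinfWeierstrassEtaPeriodHom`: for scalars `a, b` from any coefficient ring `K`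
mapped into `B_dR⁺` by `e` with `θ ∘ e` injective (e.g. `K = F`, `e = embBdRHom`, `θ ∘ e = (F ⊂ ℂ_F)`),

  `a·∫_τ ω + b·∫_τ η = 0` for all `τ`  ⇒  `a = b = 0`,

as soon as ONE `τ₁` has `∫_{τ₁} η ∉ Fil¹` (the transversality criterion `h₁ : R_p(τ₁,₁) ∉ p𝒪_{ℂ_F}` of
`AinfWeierstrassEtaPeriodTheta`) and ONE `τ₂` has `∫_{τ₂} ω ≠ 0`: apply `θ_dR` (`∫ω ∈ Fil¹ = ker θ_dR`, `θ_dR(∫_{τ₁}η) ≠ 0`,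
`ℂ_F` a field) to get `b = 0`, then `B_dR⁺` a domain gives `a = 0` (Colmez 1992 §2: the two periods are independent).
BSD context: crux K★ `stmt-BirchSwinnertonDyer-22226`, hDR sector (iii) road (A), assembly input (A6); BSD is not proved here.

## References
* P. Colmez, *Périodes p-adiques des variétés abéliennes*, Math. Ann. 292 (1992), §2. [Colmez1992PeriodesAbeliennes]
* J.-M. Fontaine, *Le corps des périodes p-adiques*, Astérisque 223 (1994), Exp. II §1.5. [FontaineAsterisque223III]
-/

noncomputable section

open Ideal Filter Topology Field WittVector MvPowerSeries

namespace Literature.NumberTheory.PAdicHodge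

open Literature.NumberTheory.GaloisRepresentations
open Literature.NumberTheory.GaloisRepresentations.IsNonarchimedeanLocalField
open Literature.NumberTheory.GaloisRepresentations.LubinTate
open Literature.NumberTheory.EllipticCurves

namespace AinfTop

variable {F : Type} [Field F] [ValuativeRel F] [TopologicalSpace F] [IsNonarchimedeanLocalField F]
  {p : ℕ} [Fact p.Prime] [Fact (¬ IsUnit (p : integerC F))]
  [IsAdicComplete (Ideal.span {(p : integerC F)}) (integerC F)] [CharZero F]
  {hθ : Function.Surjective (fontaineTheta (integerC F) p)}
  (W : WeierstrassCurve ℤ)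

/-- `θ_dR(∫_τ ω) = 0` (`∫_τ ω ∈ Fil¹ = ker θ_dR`). [cite: FontaineAsterisque223III, Exp. II §1.5.2] -/
theorem thetaBdR_omegaPeriodHom (τ : TatePt F p W) :
    thetaBdR ((BdRPlusTop.of F p).symm (omegaPeriodHom W hθ τ)) = 0 :=
  thetaBdR_eq_zero_of_mem_span (BdRPlusTop.mem_filOne_iff.1 (omegaPeriodHom_mem_filOne W τ))

/-- **Independence of `∫ω` and `∫η`** over any coefficient ring `K → B_dR⁺` on which `θ_dR` is injective: if
`e(a)·∫_τ ω + e(b)·∫_τ η = 0` for all `τ ∈ T_pŴ(𝒪_{ℂ_F})`, some `∫_{τ₁} η` is transverse to `Fil¹` (`R_p(τ₁,₁) ∉ p𝒪_{ℂ_F}`)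
and some `∫_{τ₂} ω ≠ 0`, then `a = b = 0`. [cite: Colmez1992PeriodesAbeliennes, §2] -/
theorem periodHoms_independent {K : Type*} [CommRing K] (e : K →+* BdRPlusTop F p)
    (he : ∀ x : K, thetaBdR ((BdRPlusTop.of F p).symm (e x)) = 0 → x = 0)
    (τ₁ : TatePt F p W) (h₁ : mulDefectC W p (seq W τ₁ 1) ∉ Ideal.span {(p : CBall F)})
    (τ₂ : TatePt F p W) (h₂ : omegaPeriodHom W hθ τ₂ ≠ 0) (a b : K)
    (hab : ∀ τ : TatePt F p W, e a * omegaPeriodHom W hθ τ + e b * etaPeriodHom W hθ τ = 0) : a = 0 ∧ b = 0 := by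
  -- `b = 0`: apply `θ_dR` at `τ₁`
  have hb : b = 0 := by
    have h := congrArg (fun x => thetaBdR ((BdRPlusTop.of F p).symm x)) (hab τ₁)
    simp only [map_add, map_mul, map_zero, thetaBdR_omegaPeriodHom, mul_zero, zero_add] at h
    rcases mul_eq_zero.1 h with h0 | h0
    · exact he b h0
    · exact absurd h0 (thetaBdR_etaPeriodHom_ne_zero W τ₁ h₁)
  refine ⟨?_, hb⟩
  -- `a = 0`: `e a · ∫_{τ₂} ω = 0` in the domain `B_dR⁺`
  haveI := isDomain_bDeRhamPlus (F := F) (p := p) hθ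
  have h := hab τ₂
  rw [hb, map_zero, zero_mul, add_zero] at h
  have h' : (BdRPlusTop.of F p).symm (e a) * (BdRPlusTop.of F p).symm (omegaPeriodHom W hθ τ₂) = 0 := by
    rw [← map_mul, h, map_zero]
  rcases mul_eq_zero.1 h' with h0 | h0
  · exact he a (by rw [h0, map_zero])
  · exact absurd ((BdRPlusTop.of F p).symm.map_eq_zero_iff.1 h0) h₂

/-- The same independence phrased with the scalars acting from the LEFT on both maps through `e`, in the `∀ τ`-free form
used by `PeriodRingData.isAdmissible_of_two_periodMaps` after rationalisation. [cite: Colmez1992PeriodesAbeliennes, §2] -/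
theorem periodHoms_independent' {K : Type*} [CommRing K] (e : K →+* BdRPlusTop F p)
    (he : ∀ x : K, thetaBdR ((BdRPlusTop.of F p).symm (e x)) = 0 → x = 0)
    (hτ₁ : ∃ τ₁ : TatePt F p W, mulDefectC W p (seq W τ₁ 1) ∉ Ideal.span {(p : CBall F)})
    (hτ₂ : ∃ τ₂ : TatePt F p W, omegaPeriodHom W hθ τ₂ ≠ 0) :
    ∀ a b : K, (∀ τ : TatePt F p W, e a * omegaPeriodHom W hθ τ + e b * etaPeriodHom W hθ τ = 0) → a = 0 ∧ b = 0 :=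
  fun a b hab => by
    obtain ⟨τ₁, h₁⟩ := hτ₁
    obtain ⟨τ₂, h₂⟩ := hτ₂
    exact periodHoms_independent W e he τ₁ h₁ τ₂ h₂ a b hab

end AinfTop

end Literature.NumberTheory.PAdicHodge

end
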